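import Literature.NumberTheory.LFunctions.SekatskiiGeneralizedLiCriterion
import Literature.NumberTheory.LFunctions.FreitasLiHalfPlanesProofs
import HarnessLib

/-!
# Sekatskii's generalized Li criterion — proofs (discharge of eq. (6) of [Sekatskii2014])

LABEL (line 1): **RH-FREE** theorems (sibling proofs file of
`Literature/NumberTheory/LFunctions/SekatskiiGeneralizedLiCriterion.lean`; S. K. Sekatskii, *Generalized
Bombieri–Lagarias' theorem and generalized Li's criterion with its arithmetic interpretation*, Ukr.
Math. J. **66** (2014) 415–431 [Sekatskii2014]).  bears_on: LADDER-RH L-C/L-P (COLUMN 4, LI).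
WHAT THIS IS NOT: the identity proved here turns each of Sekatskii's criteria (Theorems 5, 6, §5 —
already PROVED in the statement file conditionally on it) into hypothesis-free equivalences; they
RE-INDEX Li's criterion (the expansion point moves from `s = 1` to any real `b ≠ ½`), they do not
weaken RH, and none of them is worded as, or is, progress toward RH; nothing here bears on the
truth of RH.

## Contents

* `Sekatskii2014_sum_eq_deriv_holds` — **eq. (6) (p. 423) and its general-`σ` form (pp. 424–425),
  DISCHARGED** (with the coefficient `(2σ−2a)/(n−1)!`, the print slip `n(2σ−2a)/(n−1)!` being
  corrected in the statement file, see its TYPING NOTE): for all real `a, σ` and `n ≥ 1`,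
  `Σ_ρ m(ρ) Re(1 − ((ρ−a)/(ρ+a−2σ))ⁿ) = (2σ − 2a) · (1/(n−1)!) Re dⁿ/dzⁿ((z−a)^{n−1} ln ξ(z))|_{z=2σ−a}`.

  Sekatskii obtains (6) from his generalized Littlewood theorem (Thm 4, a contour integral of
  `log ξ` against `g̃(z) = n(2σ−2a)(z−a)^{n−1}/(z+a−2σ)^{n+1} − n(2σ−2a)/(z+a−2σ)²`, (5) and
  p. 424).  We take the SHORTER ROAD the tree already has for the two special cases `a = 0, σ = ½`
  (Li's `λ_n`, `keiperLiCoeff_eq_zero_sum_holds`, `EquivalentsKeiperLiProofs.lean`) and `a = 0`,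
  general `σ = τ/2` (Freitas' Lemma 3.1 (i), `Freitas2006_lemma_3_1_i_holds`,
  `FreitasLiHalfPlanesProofs.lean`), namely Li's own computation [Li1997, p. 326]: the
  partial-fraction series of `ξ′/ξ` coming from the Hadamard product (`IsHadamardSeq`) converges
  normally near the zero-free real point `p = 2σ − a` and may be differentiated termwise there
  (`IsHadamardSeq.hasSum_iteratedDeriv_term_at`); Leibniz' rule for `(z−a)^{n−1}·log ξ(z)` at
  `z = p` and the binomial identity `sum_range_choose_mul_pow_eq` (with `τ = p − a = 2σ − 2a` and
  `x = 1/(p − ρ)`, so that `1 − τx = (ρ − a)/(ρ − p) = (ρ−a)/(ρ+a−2σ)`) give the pair sum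
  (`IsHadamardSeq.hasSum_sekatskii_pairs`); the pairs `{ρₖ, 1−ρₖ}` enumerate the non-trivial zeros
  with multiplicity (`IsHadamardSeq.finsum_liZeroBox_eq_sum`), and by absolute convergence
  (`Sekatskii.summable_term`, statement files) the box truncations of the real parts converge to
  the `tsum` defining `liSekatskiiSumAt`.  (Sekatskii himself points out, p. 416 and (1), that Li
  "demonstrated that these sums are equal to the derivatives"; the case `σ = a` is `0 = 0`.)
* Hypothesis-free corollaries (one-liners feeding the statement file's conditional theorems):
  `sekatskii2014_thm5_holds'` (Theorem 5), `sekatskii2014_conclusion_holds'` (§5),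
  `sekatskii2014_thm6_holds'` (Theorem 6), `liSekatskiiDeriv_nonneg_of_lt_one'`.

## References

* S. K. Sekatskii, Ukr. Math. J. 66 (2014) 415–431, eq. (6) p. 423, Thm 5 p. 423, Thm 6 pp. 424–425,
  §5 p. 430 (held: `paper:doi-10-1007-s11253-014-0940-9`, PDF pp. 9–11, 16). [Sekatskii2014]
* X.-J. Li, J. Number Theory 65 (1997) 325–333, p. 326 (the method). [Li1997]
* P. Freitas, J. London Math. Soc. (2) 73 (2006) 399–414, Lemma 3.1 (i) (the case `a = 0`).
  [Freitas2006LiHalfPlanes]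
-/

noncomputable section

open Complex Filter Topology Set Metric
open scoped Nat ComplexConjugate ComplexOrder

namespace Literature.NumberTheory.LFunctions

/-! ## Calculus at a real point -/

namespace Sekatskii2014Eq6

/-- Near a real point the principal `log ξ` is a primitive of `ξ'/ξ` (`ξ > 0` on `ℝ`), hence
`(log ξ)^{(j+1)}(p) = (ξ'/ξ)^{(j)}(p)` (as in `FreitasLiHalfPlanesProofs`). [folklore] -/
private theorem iteratedDeriv_succ_log_riemannXi_ofReal (p : ℝ) (j : ℕ) :
    iteratedDeriv (j + 1) (fun s ↦ Complex.log (riemannXi s)) p =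
      iteratedDeriv j (logDeriv riemannXi) p := by
  rw [iteratedDeriv_succ']
  refine Filter.EventuallyEq.iteratedDeriv_eq j ?_
  have h1 : riemannXi p ∈ slitPlane :=
    mem_slitPlane_iff.2 (Or.inl (Complex.pos_iff.1 (riemannXi_ofReal_pos p)).1)
  have hV : ∀ᶠ s in 𝓝 (p : ℂ), riemannXi s ∈ slitPlane :=
    differentiable_riemannXi.continuous.continuousAt.eventually_mem (isOpen_slitPlane.mem_nhds h1)
  filter_upwards [hV] with s hs
  rw [((differentiable_riemannXi s).hasDerivAt.clog hs).deriv, logDeriv_apply]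

/-- `dⁱ/dsⁱ (s − a)^m |_{s=c} = m^{(i)} (c − a)^{m−i}` (falling factorial). [folklore] -/
private theorem iteratedDeriv_sub_pow (a : ℂ) (m i : ℕ) (c : ℂ) :
    iteratedDeriv i (fun s : ℂ ↦ (s - a) ^ m) c = (m.descFactorial i : ℂ) * (c - a) ^ (m - i) := by
  have h := iteratedDeriv_comp_sub_const i (fun z : ℂ ↦ z ^ m) a
  rw [show (fun s : ℂ ↦ (s - a) ^ m) = fun z ↦ (fun w : ℂ ↦ w ^ m) (z - a) from rfl, h]
  simp only [iteratedDeriv_pow]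

/-- **Leibniz' rule for `(s−a)^{n−1} g(s)` at a point `c`**: for `n ≥ 1` and `g` of class `Cⁿ` at `c`,
`dⁿ/dsⁿ[(s−a)^{n−1} g(s)]|_{s=c} = ∑_{i<n} C(n,i) (n−1)^{(i)} (c−a)^{n−1−i} g^{(n−i)}(c)` (the term
`i = n` vanishes) — Leibniz' rule as used by Li for `s^{n−1} log ξ(s)` (the tree's
`iteratedDeriv_pow_mul_one_eq_sum` is `a = 0`, `c = 1`). [cite: Li1997, p. 326 (the display after (1.4))] -/
theorem iteratedDeriv_sub_pow_mul_eq_sum_at {g : ℂ → ℂ} {n : ℕ} (hn : 1 ≤ n) (a c : ℂ)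
    (hg : ContDiffAt ℂ n g c) :
    iteratedDeriv n (fun s ↦ (s - a) ^ (n - 1) * g s) c =
      ∑ i ∈ Finset.range n, (n.choose i : ℂ) * ((n - 1).descFactorial i : ℂ) * (c - a) ^ (n - 1 - i) *
        iteratedDeriv (n - i) g c := by
  have hp : ContDiffAt ℂ n (fun s : ℂ ↦ (s - a) ^ (n - 1)) c :=
    ((contDiff_id.sub contDiff_const).pow _).contDiffAt
  rw [iteratedDeriv_fun_mul hp hg, Finset.sum_range_succ, iteratedDeriv_sub_pow,
    Nat.descFactorial_eq_zero_iff_lt.2 (by omega : n - 1 < n)]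
  simp only [Nat.cast_zero, zero_mul, mul_zero, add_zero]
  refine Finset.sum_congr rfl fun i _ ↦ ?_
  rw [iteratedDeriv_sub_pow]
  ring

end Sekatskii2014Eq6

/-! ## The partial-fraction series of `ξ'/ξ`, differentiated termwise at `p = 2σ − a` -/

namespace IsHadamardSeq

variable {b : ℕ → ℂ}

/-- **The derivatives of one pair of terms at a zero-free point `c`**: for `bₖ ≠ 0`, near `c` the
`k`-th term of `ξ'/ξ` is `1/(s−ρₖ) + 1/(s−(1−ρₖ))`, so its `j`-th derivative at `c` is
`(−1)ʲ j! [(c−ρₖ)^{−(j+1)} + (c−(1−ρₖ))^{−(j+1)}]` (the tree's `iteratedDeriv_term_one` is `c = 1`).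
[folklore] -/
private theorem iteratedDeriv_pairTerm_at (h : IsHadamardSeq 0 b) {k : ℕ} (hk : b k ≠ 0) {c : ℂ}
    (hc : riemannXi c ≠ 0) (j : ℕ) :
    iteratedDeriv j (fun s ↦ -(4 * b k * (2 * s - 1)) / (1 - b k * (2 * s - 1) ^ 2)) c =
      (-1) ^ j * j ! * (((c - xiZero b k)⁻¹) ^ (j + 1) + ((c - (1 - xiZero b k))⁻¹) ^ (j + 1)) := by
  set ρ := xiZero b k with hρ
  have hρ0 : riemannXi ρ = 0 := h.riemannXi_xiZero hk
  have hρ1 : riemannXi (1 - ρ) = 0 := h.riemannXi_one_sub_xiZero hk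
  have hev : ∀ᶠ s in 𝓝 c, riemannXi s ≠ 0 :=
    differentiable_riemannXi.continuous.continuousAt.eventually_ne hc
  have hfe : (fun s ↦ -(4 * b k * (2 * s - 1)) / (1 - b k * (2 * s - 1) ^ 2)) =ᶠ[𝓝 c]
      fun s ↦ (1 * s - ρ)⁻¹ + (1 * s - (1 - ρ))⁻¹ := by
    filter_upwards [hev] with s hs
    have hs1 : s ≠ ρ := fun e ↦ hs (by rw [e]; exact hρ0)
    have hs2 : s ≠ 1 - ρ := fun e ↦ hs (by rw [e]; exact hρ1)
    rw [term_eq_inv_add_inv b hk hs1 hs2]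
    simp only [one_div, one_mul]
    rfl
  rw [hfe.iteratedDeriv_eq]
  have hne1 : c - ρ ≠ 0 := fun e ↦ hc (by rw [sub_eq_zero.1 e]; exact hρ0)
  have hne2 : c - (1 - ρ) ≠ 0 := fun e ↦ hc (by rw [sub_eq_zero.1 e]; exact hρ1)
  have hc1 : ContDiffAt ℂ j (fun s : ℂ ↦ (1 * s - ρ)⁻¹) c := by
    refine ContDiffAt.inv (by fun_prop) (by simpa using hne1)
  have hc2 : ContDiffAt ℂ j (fun s : ℂ ↦ (1 * s - (1 - ρ))⁻¹) c := by
    refine ContDiffAt.inv (by fun_prop) (by simpa using hne2)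
  rw [iteratedDeriv_fun_add hc1 hc2, iteratedDeriv_eq_iterate, iteratedDeriv_eq_iterate,
    iter_deriv_inv_linear_sub j 1 ρ, iter_deriv_inv_linear_sub j 1 (1 - ρ)]
  simp only [one_pow, mul_one, one_mul]
  have ez : ∀ w : ℂ, w ^ (-1 - j : ℤ) = (w⁻¹) ^ (j + 1) := by
    intro w
    rw [show (-1 - j : ℤ) = -((j + 1 : ℕ) : ℤ) by push_cast; ring, zpow_neg, zpow_natCast, inv_pow]
  rw [ez, ez]
  ring

open Sekatskii2014Eq6 in
/-- **Sekatskii's eq. (6), pair by pair** (Li's computation [Li1997, p. 326] at the point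
`p = 2σ − a` for the function `(z−a)^{n−1} ln ξ(z)`): for a Hadamard sequence `b` of `H₀`, `n ≥ 1`
and real `a ≠ p`,
`(p − a) · (1/(n−1)!) dⁿ/dzⁿ[(z−a)^{n−1} log ξ(z)]|_{z=p}
  = ∑ₖ ([1 − ((ρₖ−a)/(ρₖ−p))ⁿ] + [1 − ((1−ρₖ−a)/(1−ρₖ−p))ⁿ])`,
summed over the pairs `{ρₖ, 1 − ρₖ}` of the Hadamard product (unconditionally convergent; the padding
indices `bₖ = 0` contribute `0`).  The tree's `hasSum_freitas_pairs` is `a = 0`, `p = τ`.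
[cite: Sekatskii2014, eq. (6) p. 423 and pp. 424–425] -/
theorem hasSum_sekatskii_pairs (h : IsHadamardSeq 0 b) {n : ℕ} (hn : 1 ≤ n) {a p : ℝ}
    (hap : a ≠ p) :
    HasSum (fun k ↦ if b k = 0 then (0 : ℂ) else
        ((1 - ((xiZero b k - a) / (xiZero b k - p)) ^ n) +
          (1 - ((1 - xiZero b k - a) / (1 - xiZero b k - p)) ^ n)))
      ((p - a : ℂ) * (iteratedDeriv n (fun s : ℂ ↦ (s - a) ^ (n - 1) * Complex.log (riemannXi s)) p /
        ((n - 1)! : ℂ))) := by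
  have hτ' : (p : ℂ) - a ≠ 0 := by
    rw [← Complex.ofReal_sub]; exact Complex.ofReal_ne_zero.2 (sub_ne_zero.2 (Ne.symm hap))
  have hξ : riemannXi p ≠ 0 := (riemannXi_ofReal_pos p).ne'
  have hg : ContDiffAt ℂ n (fun s ↦ Complex.log (riemannXi s)) p :=
    (analyticAt_log_riemannXi_ofReal p).contDiffAt
  -- the coefficient of the `(n−i)`-th derivative of `log ξ`, times `(p−a)/(n−1)!`
  set c : ℕ → ℂ := fun i ↦ ((p : ℂ) - a) * ((n.choose i : ℂ) * ((n - 1).descFactorial i : ℂ) *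
    ((p : ℂ) - a) ^ (n - 1 - i)) / ((n - 1)! : ℂ) with hcdef
  have hsum := hasSum_sum (s := Finset.range n)
    (f := fun i k ↦ c i *
      iteratedDeriv (n - 1 - i) (fun s ↦ -(4 * b k * (2 * s - 1)) / (1 - b k * (2 * s - 1) ^ 2)) p)
    fun i _ ↦ (h.hasSum_iteratedDeriv_term_at hξ (n - 1 - i)).mul_left (c i)
  convert hsum using 1
  · funext k
    split_ifs with hk
    · simp [hk]
    · simp only [h.iteratedDeriv_pairTerm_at hk hξ]
      set ρ := xiZero b k
      -- `(n−1)^{(i)} (n−1−i)! = (n−1)!`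
      have hfac : ∀ i ∈ Finset.range n,
          c i * ((-1) ^ (n - 1 - i) * ((n - 1 - i)! : ℂ) *
            ((((p : ℂ) - ρ)⁻¹) ^ (n - 1 - i + 1) + (((p : ℂ) - (1 - ρ))⁻¹) ^ (n - 1 - i + 1))) =
          ((p : ℂ) - a) * ((n.choose i : ℂ) * ((p : ℂ) - a) ^ (n - 1 - i) *
              ((-1) ^ (n - 1 - i) * (((p : ℂ) - ρ)⁻¹) ^ (n - i))) +
            ((p : ℂ) - a) * ((n.choose i : ℂ) * ((p : ℂ) - a) ^ (n - 1 - i) *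
              ((-1) ^ (n - 1 - i) * (((p : ℂ) - (1 - ρ))⁻¹) ^ (n - i))) := by
        intro i hi
        have hi' : i < n := Finset.mem_range.1 hi
        have key : (((n - 1).descFactorial i : ℕ) : ℂ) * ((n - 1 - i)! : ℂ) = ((n - 1)! : ℂ) := by
          have e := Nat.factorial_mul_descFactorial (show i ≤ n - 1 by omega)
          rw [mul_comm] at e
          exact_mod_cast e
        have h0 : ((n - 1)! : ℂ) ≠ 0 := by exact_mod_cast (Nat.factorial_pos _).ne'
        rw [show n - 1 - i + 1 = n - i by omega, hcdef]
        simp only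
        rw [show ((p : ℂ) - a) * ((n.choose i : ℂ) * ((n - 1).descFactorial i : ℂ) *
              ((p : ℂ) - a) ^ (n - 1 - i)) / ((n - 1)! : ℂ) * ((-1) ^ (n - 1 - i) * ((n - 1 - i)! : ℂ) *
              ((((p : ℂ) - ρ)⁻¹) ^ (n - i) + (((p : ℂ) - (1 - ρ))⁻¹) ^ (n - i))) =
            ((p : ℂ) - a) * (n.choose i : ℂ) * ((p : ℂ) - a) ^ (n - 1 - i) * (-1) ^ (n - 1 - i) *
              ((((n - 1).descFactorial i : ℕ) : ℂ) * ((n - 1 - i)! : ℂ) / ((n - 1)! : ℂ)) *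
              ((((p : ℂ) - ρ)⁻¹) ^ (n - i) + (((p : ℂ) - (1 - ρ))⁻¹) ^ (n - i)) by ring,
          key, div_self h0]
        ring
      rw [Finset.sum_congr rfl hfac, Finset.sum_add_distrib, ← Finset.mul_sum, ← Finset.mul_sum,
        sum_range_choose_mul_pow_eq _ hτ', sum_range_choose_mul_pow_eq _ hτ', ← mul_assoc,
        ← mul_assoc, mul_inv_cancel₀ hτ', one_mul, one_mul]
      have hpρ : (p : ℂ) - ρ ≠ 0 := fun e ↦ hξ (by rw [sub_eq_zero.1 e]; exact h.riemannXi_xiZero hk)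
      have hpρ' : (p : ℂ) - (1 - ρ) ≠ 0 := fun e ↦
        hξ (by rw [sub_eq_zero.1 e]; exact h.riemannXi_one_sub_xiZero hk)
      have hρp : ρ - (p : ℂ) ≠ 0 := fun e ↦ hpρ (by rw [← neg_sub, e, neg_zero])
      have hρp' : (1 - ρ) - (p : ℂ) ≠ 0 := fun e ↦ hpρ' (by rw [← neg_sub, e, neg_zero])
      have e1 : 1 - ((p : ℂ) - a) * ((p : ℂ) - ρ)⁻¹ = (ρ - a) / (ρ - p) := by
        rw [eq_div_iff hρp]
        field_simp
        ring
      have e2 : 1 - ((p : ℂ) - a) * ((p : ℂ) - (1 - ρ))⁻¹ = (1 - ρ - a) / (1 - ρ - p) := by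
        rw [eq_div_iff hρp']
        field_simp
        ring
      rw [e1, e2]
  · rw [iteratedDeriv_sub_pow_mul_eq_sum_at hn _ _ hg, Finset.sum_div, Finset.mul_sum]
    refine Finset.sum_congr rfl fun i hi ↦ ?_
    have hi' : i < n := Finset.mem_range.1 hi
    rw [show n - i = (n - 1 - i) + 1 by omega, iteratedDeriv_succ_log_riemannXi_ofReal, hcdef]
    ring

end IsHadamardSeq

/-! ## From the Hadamard pairs to the zeros with multiplicity: eq. (6) -/

namespace Sekatskii2014Eq6

open ZetaZeros

/-- Multiplicity of a non-trivial zero as a natural number. [folklore] -/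
private theorem toNat_cast_order (ρ : ZetaZeros.riemannZetaNontrivialZeros) :
    (((riemannZetaZeroOrder (ρ : ℂ)).toNat : ℕ) : ℝ) = (riemannZetaZeroOrder (ρ : ℂ) : ℝ) := by
  have h := riemannZetaNontrivialZeros.one_le_order ρ.2
  have : ((riemannZetaZeroOrder (ρ : ℂ)).toNat : ℤ) = riemannZetaZeroOrder (ρ : ℂ) :=
    Int.toNat_of_nonneg (by omega)
  exact_mod_cast this

/-- The multiplicities are positive. [folklore] -/
private theorem toNat_order_pos (ρ : ZetaZeros.riemannZetaNontrivialZeros) :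
    0 < (riemannZetaZeroOrder (ρ : ℂ)).toNat := by
  have := riemannZetaNontrivialZeros.one_le_order ρ.2; omega

/-- A non-trivial zero is not real. [folklore] -/
private theorem coe_ne_ofReal (ρ : ZetaZeros.riemannZetaNontrivialZeros) (x : ℝ) : (ρ : ℂ) ≠ x := by
  intro h
  have := riemannZetaNontrivialZeros.im_ne_zero ρ.2
  rw [h, ofReal_im] at this
  exact this rfl

/-- **Absolute convergence of Sekatskii's family at level `σ`** with the `ℤ`-valued multiplicities of
the tree: for `a ≠ σ`, `Σ_ρ m(ρ) Re(1 − ((ρ−a)/(ρ−p))ⁿ)`, `p = 2σ − a`, converges absolutely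
(`Sekatskii.summable_term` with `Sekatskii.summable_weight_zetaZeros`). [cite: Sekatskii2014, Thm 2 (ii) and Thm 6 (proof)] -/
theorem summable_term_at {a σ : ℝ} (haσ : a ≠ σ) (n : ℕ) :
    Summable fun ρ : ZetaZeros.riemannZetaNontrivialZeros ↦
      (riemannZetaZeroOrder (ρ : ℂ) : ℝ) *
        (1 - (((ρ : ℂ) - a) / ((ρ : ℂ) - ((2 * σ - a : ℝ) : ℂ))) ^ n).re := by
  have h := Sekatskii.summable_term (ρ := fun ρ : ZetaZeros.riemannZetaNontrivialZeros ↦ (ρ : ℂ))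
    (m := fun ρ ↦ (riemannZetaZeroOrder (ρ : ℂ)).toNat) (a := a) (σ := σ) haσ toNat_order_pos
    (Sekatskii.summable_weight_zetaZeros a σ) n
  refine h.congr fun ρ ↦ ?_
  rw [toNat_cast_order]
  congr 4
  push_cast
  ring

/-- `liZeroBox T` is the box `weilZeroIndex T` of the explicit-formula files. [folklore] -/
private theorem liZeroBox_eq_weilZeroIndex (T : ℝ) : liZeroBox T = weilZeroIndex T := by
  ext ρ
  simp only [liZeroBox, weilZeroIndex, mem_setOf_eq, abs_pos]

end Sekatskii2014Eq6

open ZetaZeros Sekatskii2014Eq6 in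
/-- **Sekatskii 2014, eq. (6) (p. 423) and its general-`σ` form (pp. 424–425)** — DISCHARGED: for
all real `a, σ` and `n ≥ 1`,
`Σ_ρ m(ρ) Re(1 − ((ρ−a)/(ρ+a−2σ))ⁿ) = (2σ − 2a) · (1/(n−1)!) Re dⁿ/dzⁿ((z−a)^{n−1} ln ξ(z))|_{z=2σ−a}`
(coefficient as typed, print slip corrected — statement file).  Proof (Li's method, as for the
tree's `keiperLiCoeff_eq_zero_sum_holds` / `Freitas2006_lemma_3_1_i_holds`): for `σ ≠ a`, the
logarithmic derivative of the Hadamard product differentiated termwise at `p = 2σ − a`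
(`IsHadamardSeq.hasSum_sekatskii_pairs`) gives the pair sum; the pairs `{ρₖ, 1−ρₖ}` enumerate the
zeros with multiplicity (`IsHadamardSeq.finsum_liZeroBox_eq_sum`), so the box truncations converge to
`(2σ−2a)·D`; by absolute convergence (`Sekatskii2014Eq6.summable_term_at`) the box sums of the real
parts converge to the `tsum`.  For `σ = a` every term is `Re(1 − 1ⁿ) = 0` (a non-trivial zero is not
the real number `a`) and both sides vanish. [cite: Sekatskii2014, eq. (6) p. 423; pp. 424–425] -/
theorem Sekatskii2014_sum_eq_deriv_holds : Sekatskii2014_sum_eq_deriv := by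
  intro a σ n hn
  -- the point `p = 2σ − a` and the increment `p − a = 2σ − 2a`
  set p : ℝ := 2 * σ - a with hpdef
  have hsumAt : liSekatskiiSumAt a σ n = ∑' ρ : ZetaZeros.riemannZetaNontrivialZeros,
      (riemannZetaZeroOrder (ρ : ℂ) : ℝ) * (1 - (((ρ : ℂ) - a) / ((ρ : ℂ) - (p : ℂ))) ^ n).re := by
    unfold liSekatskiiSumAt
    refine tsum_congr fun ρ ↦ ?_
    rw [hpdef]
    congr 4
    push_cast
    ring
  have hderiv : (2 * σ - 2 * a) * liSekatskiiDeriv a (2 * σ - a) n =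
      ((p : ℂ) - a).re * (iteratedDeriv n
        (fun z : ℂ ↦ (z - a) ^ (n - 1) * Complex.log (riemannXi z)) p / ((n - 1)! : ℂ)).re := by
    rw [liSekatskiiDeriv, hpdef]
    simp only [sub_re, ofReal_re]
    ring
  rw [hsumAt, hderiv]
  by_cases haσ : a = σ
  · -- `σ = a`: `p = a`, every term vanishes
    have hp : p = a := by rw [hpdef, haσ]; ring
    rw [hp]
    simp only [sub_self, Complex.zero_re, zero_mul]
    refine (tsum_congr fun ρ ↦ ?_).trans tsum_zero
    rw [div_self (sub_ne_zero.2 (coe_ne_ofReal ρ a)), one_pow, sub_self, Complex.zero_re, mul_zero]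
  have hap : a ≠ p := by
    rw [hpdef]; intro e; apply haσ; linarith
  classical
  obtain ⟨b, hb⟩ := exists_isHadamardSeq 0
  set D : ℂ := iteratedDeriv n (fun z : ℂ ↦ (z - a) ^ (n - 1) * Complex.log (riemannXi z)) p /
    ((n - 1)! : ℂ) with hD
  set f : ℂ → ℂ := fun ρ ↦ 1 - ((ρ - a) / (ρ - p)) ^ n with hf
  set G : ℕ → ℂ := fun k ↦
    if b k = 0 then 0 else f (IsHadamardSeq.xiZero b k) + f (1 - IsHadamardSeq.xiZero b k)
    with hG
  have hGD : HasSum G (((p : ℂ) - a) * D) := by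
    have := hb.hasSum_sekatskii_pairs hn hap
    simpa only [hG, hf] using this
  set K : ℝ → Finset ℕ := fun T ↦ (hb.finite_setOf_abs_im_xiZero_le T).toFinset with hKdef
  have hK : ∀ T k, k ∈ K T ↔ b k ≠ 0 ∧ |(IsHadamardSeq.xiZero b k).im| ≤ T := fun T k ↦ by
    simp [hKdef, Set.Finite.mem_toFinset]
  have hlim : Tendsto (fun T ↦ ∑ k ∈ K T, G k) atTop (𝓝 (((p : ℂ) - a) * D)) :=
    IsHadamardSeq.tendsto_sum_truncation hGD (fun k hk ↦ by simp [hG, hk]) K hK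
  have heq : ∀ T, ∑ᶠ ρ ∈ liZeroBox T, (riemannZetaZeroOrder ρ : ℂ) * f ρ = ∑ k ∈ K T, G k := by
    intro T
    rw [hb.finsum_liZeroBox_eq_sum f T (K T) (hK T)]
    refine Finset.sum_congr rfl fun k hk ↦ ?_
    simp [hG, ((hK T k).1 hk).1]
  have hbox : Tendsto (fun T ↦ (∑ᶠ ρ ∈ liZeroBox T, (riemannZetaZeroOrder ρ : ℂ) * f ρ).re)
      atTop (𝓝 ((((p : ℂ) - a) * D).re)) := by
    have h1 : Tendsto (fun T ↦ ∑ᶠ ρ ∈ liZeroBox T, (riemannZetaZeroOrder ρ : ℂ) * f ρ)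
        atTop (𝓝 (((p : ℂ) - a) * D)) := by simpa only [heq] using hlim
    exact (Complex.continuous_re.tendsto _).comp h1
  -- the same box sums, real parts, converge to the `tsum` by absolute convergence
  set F : ZetaZeros.riemannZetaNontrivialZeros → ℝ := fun ρ ↦
    (riemannZetaZeroOrder (ρ : ℂ) : ℝ) * (1 - (((ρ : ℂ) - a) / ((ρ : ℂ) - (p : ℂ))) ^ n).re with hF
  have hFs : Summable F := by
    have := summable_term_at (a := a) (σ := σ) haσ n
    simpa only [hF, hpdef] using this
  have hlim2 := hFs.hasSum.comp tendsto_weilZeroFinset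
  have hident : ∀ T, (∑ᶠ ρ ∈ liZeroBox T, (riemannZetaZeroOrder ρ : ℂ) * f ρ).re =
      ∑ ρ ∈ weilZeroFinset T, F ρ := by
    intro T
    rw [liZeroBox_eq_weilZeroIndex, ZetaZeroSum.finsum_mem_weilZeroIndex_eq_sum, Complex.re_sum]
    refine Finset.sum_congr rfl fun ρ _ ↦ ?_
    simp only [hF, hf, Complex.mul_re, Complex.intCast_re, Complex.intCast_im, zero_mul, sub_zero]
  have hbox' : Tendsto (fun T ↦ ∑ ρ ∈ weilZeroFinset T, F ρ) atTop
      (𝓝 ((((p : ℂ) - a) * D).re)) := hbox.congr fun T ↦ hident T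
  have huniq : ∑' ρ, F ρ = (((p : ℂ) - a) * D).re := tendsto_nhds_unique hlim2 hbox'
  rw [show (∑' ρ : ZetaZeros.riemannZetaNontrivialZeros, (riemannZetaZeroOrder (ρ : ℂ) : ℝ) *
      (1 - (((ρ : ℂ) - a) / ((ρ : ℂ) - (p : ℂ))) ^ n).re) = ∑' ρ, F ρ from rfl, huniq]
  have hreal : ((p : ℂ) - a) = ((p - a : ℝ) : ℂ) := by push_cast; ring
  rw [hreal, Complex.re_ofReal_mul, Complex.ofReal_re]

/-! ## Hypothesis-free forms of Theorems 5, 6 and §5 -/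

/-- **Sekatskii 2014, Theorem 5** (p. 423), hypothesis-free: for every real `a < ½`,
`RH ⟺ ∀ n ≥ 1, (1/(n−1)!) dⁿ/dzⁿ((z−a)^{n−1} ln ξ(z))|_{z=1−a} ≥ 0`, and for every real `a > ½`,
`RH ⟺` all these derivatives are `≤ 0` (`sekatskii2014_thm5` fed with eq. (6)).  RH-EQUIVALENT as
printed; neither side is asserted. [cite: Sekatskii2014, Thm 5 p. 423] -/
theorem sekatskii2014_thm5_holds' :
    (∀ a : ℝ, a < 1 / 2 →
      (RiemannHypothesis ↔ ∀ n : ℕ, 1 ≤ n → 0 ≤ liSekatskiiDeriv a (1 - a) n)) ∧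
    (∀ a : ℝ, 1 / 2 < a →
      (RiemannHypothesis ↔ ∀ n : ℕ, 1 ≤ n → liSekatskiiDeriv a (1 - a) n ≤ 0)) :=
  sekatskii2014_thm5 Sekatskii2014_sum_eq_deriv_holds

/-- **§5, Conclusions** (p. 430), hypothesis-free: for every `b > −½`,
`RH ⟺ ∀ n ≥ 1, (1/(n−1)!) dⁿ/dzⁿ((z+b)^{n−1} ln ξ(z))|_{z=b+1} ≥ 0`.  RH-EQUIVALENT as printed;
neither side is asserted. [cite: Sekatskii2014, §5 p. 430] -/
theorem sekatskii2014_conclusion_holds' {b : ℝ} (hb : -1 / 2 < b) :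
    RiemannHypothesis ↔ ∀ n : ℕ, 1 ≤ n → 0 ≤ liSekatskiiDeriv (-b) (b + 1) n :=
  sekatskii2014_conclusion Sekatskii2014_sum_eq_deriv_holds hb

/-- **Sekatskii 2014, Theorem 6** (p. 424), hypothesis-free: for every real `σ`, "no non-trivial
zero has `Re ρ > σ`" `⟺` (for every `a < σ` all derivatives at `z = 2σ − a` are `≥ 0`) `∧` (for every
`a > 1 − σ` all derivatives at `z = 2 − 2σ − a` are `≤ 0`).  RH-FREE equivalence (at `σ = ½` it is
Theorem 5). [cite: Sekatskii2014, Thm 6 pp. 424–425] -/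
theorem sekatskii2014_thm6_holds' (σ : ℝ) :
    (∀ ρ : ZetaZeros.riemannZetaNontrivialZeros, (ρ : ℂ).re ≤ σ) ↔
      ((∀ a : ℝ, a < σ → ∀ n : ℕ, 1 ≤ n → 0 ≤ liSekatskiiDeriv a (2 * σ - a) n) ∧
       (∀ a : ℝ, 1 - σ < a → ∀ n : ℕ, 1 ≤ n → liSekatskiiDeriv a (2 - 2 * σ - a) n ≤ 0)) :=
  sekatskii2014_thm6 Sekatskii2014_sum_eq_deriv_holds σ

/-- The unconditional `σ = 1` instance of Theorem 6 (RH-FREE): for every `a < 1` and `n ≥ 1`,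
`(1/(n−1)!) dⁿ/dzⁿ((z−a)^{n−1} ln ξ(z))|_{z=2−a} ≥ 0`. [cite: Sekatskii2014, Thm 6 (case σ = 1)] -/
theorem liSekatskiiDeriv_nonneg_of_lt_one' {a : ℝ} (ha : a < 1) {n : ℕ} (hn : 1 ≤ n) :
    0 ≤ liSekatskiiDeriv a (2 - a) n :=
  liSekatskiiDeriv_nonneg_of_lt_one Sekatskii2014_sum_eq_deriv_holds ha hn

end Literature.NumberTheory.LFunctions
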